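import Literature.Combinatorics.Enumerative.AperyGaussCongruences
import Literature.Combinatorics.Enumerative.SporadicSupercongruenceTermProofs
import Literature.Combinatorics.Enumerative.SporadicSupercongruenceGZeroProofs
import Literature.Combinatorics.Enumerative.MultivariateAperyPrimePowerProofs
import Mathlib.Tactic
import HarnessLib

/-!
# Osburn–Sahu–Straub 2016, Theorem 1.2 (PROVED): `𝒮(mp^r; A,B,C) ≡ 𝒮(mp^{r−1}; A,B,C) (mod p^{3r})` for the sporadic family

Topic `Literature/Combinatorics/Enumerative`, namespace `Literature.Combinatorics.Enumerative.SporadicSupercongruenceProofs`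
(last file of the chain `SporadicSupercongruence{Term,HalfBlock,Companion,GZero}Proofs` → this file). PROOF FILE:
sorry-free theorems only — no definition, no named fact. It DISCHARGES the named fact
`AperyGaussCongruences.oss2016_theorem12` of the statement file `AperyGaussCongruences.lean` (whose docstring holds the
verbatim statement). Source read on the page (held `paper:arxiv-1312.2195`, §1 (11)–(12), §2 pp. 5–6): R. Osburn,
B. Sahu, A. Straub, *Supercongruences for sporadic sequences*, Proc. Edinb. Math. Soc. **59** (2016) 503–518
[OsburnSahuStraub2016]. HONEST FRAMING (cell pub-zeta5): a KNOWN prime-power supercongruence (2016) for Apéry-like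
sporadic sequences (Franel `(3,0,0)`, Apéry `(2,1,0)`/`(2,2,0)`, Cooper's `s₇ = (2,1,1)`, Yang–Zudilin `s₁₀ = (4,0,0)`,
`(ε) = (2,0,2)`), made a theorem of the tree along its printed proof; nothing here concerns `ζ(5)` or any irrationality
statement.

## What is printed (verbatim, [OsburnSahuStraub2016])

§1: «For integers `A`, `B`, `C`, let (11) `𝒮(n; A,B,C) = Σ_{k=0}^{n} C(n,k)^A C(n+k,k)^B C(2k,n)^C`. …
Theorem 1.2. Let `A ≥ 2` and `B, C ≥ 0` be integers. For any integers `m, r ≥ 1` and primes `p ≥ 5`, we have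
(12) `𝒮(mp^r; A,B,C) ≡ 𝒮(mp^{r−1}; A,B,C) (mod p^{3r})`.»
§2, Proof of Theorem 1.2: «we split the binomial sum (11) as `𝒮(mp^r; A,B,C) = Σ_{s≥0} G_s(mp^r)`, where
`G_s(n) = Σ'_k ℬ(n, kp^s)`. It follows from Lemma 2.3 that, for `s ≥ 1`, `G_s(mp^r) ≡ G_{s−1}(mp^{r−1}) (mod p^{3r})`.
It therefore remains to show that `G₀(mp^r) = Σ'_k ℬ(mp^r, k) ≡ 0 (mod p^{3r})`.»

## What is proved

As in the tree's `MultivariateAperyPrimePowerProofs.straubA_prime_pow_modEq` (Straub 2014 / Coster), the term `k = 0`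
(kept inside `Σ'_k` in print) is split off: `ℬ(n, 0) = C(0, n)^C` is the same for `n = mp^r` and `n = mp^{r−1}`
(both `0^C`, as `n ≥ 1`); the regrouping is `sum_eq_sum_digits`, Lemma 2.3 is `…TermProofs.termS_modEq`, and (G0) is
`…GZeroProofs.pow_dvd_sum_not_dvd_termS`.
* **`ossS_prime_pow_modEq`** — (12) for `n = p^r m`; **`oss2016_theorem12_holds : AperyGaussCongruences.oss2016_theorem12`**
  (hence `AperyGaussCongruences.coster1988_of_oss2016` is unconditional — a second route to Coster's supercongruence,
  beside `MultivariateAperyPrimePowerProofs.coster1988_supercongruence_holds`).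
-/

open Finset

namespace Literature.Combinatorics.Enumerative.SporadicSupercongruenceProofs

open AperyGaussCongruences (ossS)
open MultivariateAperyPrimePowerProofs (sum_eq_sum_digits)

section Assembly

variable {p : ℕ} [hp : Fact p.Prime]

/-- **Osburn–Sahu–Straub 2016, Theorem 1.2 (12), PROVED**: for a prime `p ≥ 5`, `A ≥ 2`, `B, C ≥ 0`, `r ≥ 1` and
`m ≥ 1`, `𝒮(p^r m; A,B,C) ≡ 𝒮(p^{r−1} m; A,B,C) (mod p^{3r})`. Printed route: `𝒮(mp^r) = ℬ(mp^r, 0) + Σ_s G_s(mp^r)`,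
`G_s(mp^r) ≡ G_{s−1}(mp^{r−1})` for `s ≥ 1` (Lemma 2.3, Jacobsthal) and `G₀(mp^r) ≡ 0 (mod p^{3r})` (Lemmas 2.2, 2.4,
2.5 and the half-block induction). [cite: OsburnSahuStraub2016, Theorem 1.2 (12)] -/
theorem ossS_prime_pow_modEq (h5 : 5 ≤ p) {A : ℕ} (hA : 2 ≤ A) (B C : ℕ) {r : ℕ} (hr : 1 ≤ r) {m : ℕ}
    (hm : 1 ≤ m) :
    (ossS A B C (p ^ r * m) : ℤ) ≡ ossS A B C (p ^ (r - 1) * m) [ZMOD (p : ℤ) ^ (3 * r)] := by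
  have hp' := hp.out
  have h3 : 3 < p := by omega
  have hA0 : A ≠ 0 := by omega
  -- the summands
  set t : ℕ → ℤ := fun K => ((((p ^ r * m).choose K) ^ A * ((p ^ r * m + K).choose K) ^ B *
    ((2 * K).choose (p ^ r * m)) ^ C : ℕ) : ℤ) with ht
  set t' : ℕ → ℤ := fun K => ((((p ^ (r - 1) * m).choose K) ^ A * ((p ^ (r - 1) * m + K).choose K) ^ B *
    ((2 * K).choose (p ^ (r - 1) * m)) ^ C : ℕ) : ℤ) with ht'
  have hNpos : 0 < p ^ r * m := Nat.mul_pos (pow_pos hp'.pos r) hm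
  have hN'pos : 0 < p ^ (r - 1) * m := Nat.mul_pos (pow_pos hp'.pos (r - 1)) hm
  have hNN' : p ^ (r - 1) * m ≤ p ^ r * m := Nat.mul_le_mul_right m (Nat.pow_le_pow_right hp'.pos (by omega))
  have htN : ∀ K, p ^ r * m < K → t K = 0 := fun K hK => by
    simp only [ht, Nat.choose_eq_zero_of_lt hK, zero_pow hA0, zero_mul, Nat.cast_zero]
  have ht'N' : ∀ K, p ^ (r - 1) * m < K → t' K = 0 := fun K hK => by
    simp only [ht', Nat.choose_eq_zero_of_lt hK, zero_pow hA0, zero_mul, Nat.cast_zero]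
  have ht'N : ∀ K, p ^ r * m < K → t' K = 0 := fun K hK => ht'N' K (lt_of_le_of_lt hNN' hK)
  have hS : (ossS A B C (p ^ r * m) : ℤ) = ∑ K ∈ range (p ^ r * m + 1), t K := by
    simp only [ossS, Nat.cast_sum, ht]
  have hS' : (ossS A B C (p ^ (r - 1) * m) : ℤ) = ∑ K ∈ range (p ^ r * m + 1), t' K := by
    have h1 : (ossS A B C (p ^ (r - 1) * m) : ℤ) = ∑ K ∈ range (p ^ (r - 1) * m + 1), t' K := by
      simp only [ossS, Nat.cast_sum, ht']
    rw [h1]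
    refine Finset.sum_subset (fun x hx => Finset.mem_range.mpr
      (by have := Finset.mem_range.mp hx; omega)) fun K _ hK' => ?_
    have hlt : ¬ K < p ^ (r - 1) * m + 1 := fun h => hK' (Finset.mem_range.mpr h)
    exact ht'N' K (by omega)
  -- regroup both sides by the valuation of `K`
  have hpow : p ^ r * m < p ^ (p ^ r * m + 1) :=
    (Nat.lt_pow_self hp'.one_lt).trans_le (Nat.pow_le_pow_right hp'.pos (by omega))
  rw [hS, hS', sum_eq_sum_digits (p := p) hpow t htN, sum_eq_sum_digits (p := p) hpow t' ht'N]
  refine Int.ModEq.add ?_ ?_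
  · -- `K = 0`: `ℬ(n, 0) = C(0, n)^C`, equal on both sides since `n ≥ 1`
    have h0 : t 0 = t' 0 := by
      simp only [ht, ht', mul_zero, Nat.choose_zero_right, Nat.add_zero, Nat.choose_eq_zero_of_lt hNpos,
        Nat.choose_eq_zero_of_lt hN'pos]
    rw [h0]
  · -- the `G_s`: `G₀(mp^r) ≡ 0`, `G_{s+1}(mp^r) ≡ G_s(mp^{r−1})`, the top `G_S(mp^{r−1})` being `0`
    rw [Finset.sum_range_succ' (fun s => ∑ k ∈ range (p ^ r * m + 1), if p ∣ k then 0 else t (p ^ s * k)),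
      Finset.sum_range_succ (fun s => ∑ k ∈ range (p ^ r * m + 1), if p ∣ k then 0 else t' (p ^ s * k))]
    have hG0 : ∑ k ∈ range (p ^ r * m + 1), (if p ∣ k then 0 else t (p ^ 0 * k)) ≡ 0
        [ZMOD (p : ℤ) ^ (3 * r)] := by
      simp only [pow_zero, one_mul, ht]
      exact Int.modEq_zero_iff_dvd.mpr (pow_dvd_sum_not_dvd_termS (p := p) h5 hA B C hr hm)
    have hGtop : ∑ k ∈ range (p ^ r * m + 1), (if p ∣ k then 0 else t' (p ^ (p ^ r * m) * k)) = 0 := by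
      refine Finset.sum_eq_zero fun k _ => ?_
      split_ifs with hk
      · rfl
      · have hk1 : 1 ≤ k := Nat.one_le_iff_ne_zero.mpr fun h0 => hk (h0 ▸ dvd_zero p)
        apply ht'N
        have h1 : p ^ r * m < p ^ (p ^ r * m) := Nat.lt_pow_self hp'.one_lt
        have h2 : p ^ (p ^ r * m) ≤ p ^ (p ^ r * m) * k := Nat.le_mul_of_pos_right _ hk1
        omega
    have hGs : ∀ s ∈ range (p ^ r * m),
        ∑ k ∈ range (p ^ r * m + 1), (if p ∣ k then 0 else t (p ^ (s + 1) * k)) ≡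
        ∑ k ∈ range (p ^ r * m + 1), (if p ∣ k then 0 else t' (p ^ s * k)) [ZMOD (p : ℤ) ^ (3 * r)] := by
      intro s _
      refine Int.ModEq.sum fun k _ => ?_
      split_ifs with hk
      · rfl
      · have hk1 : 1 ≤ k := Nat.one_le_iff_ne_zero.mpr fun h0 => hk (h0 ▸ dvd_zero p)
        have h := termS_modEq (p := p) h3 hA B C hr (show 1 ≤ s + 1 by omega) hk1 hk hm
        simp only [Nat.add_sub_cancel] at h
        simp only [ht, ht']
        rw [mul_left_comm 2 (p ^ (s + 1)) k, mul_left_comm 2 (p ^ s) k]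
        exact h
    rw [hGtop, add_zero]
    have := (Int.ModEq.sum hGs).add hG0
    rw [add_zero] at this
    exact this

/-- **Osburn–Sahu–Straub 2016, Theorem 1.2** — the named fact `AperyGaussCongruences.oss2016_theorem12` is a
THEOREM: for primes `p ≥ 5`, `A ≥ 2`, `B, C ≥ 0`, `m, r ≥ 1`, `𝒮(mp^r; A,B,C) ≡ 𝒮(mp^{r−1}; A,B,C) (mod p^{3r})`.
[cite: OsburnSahuStraub2016, Theorem 1.2 (12)] -/
theorem oss2016_theorem12_holds : AperyGaussCongruences.oss2016_theorem12 := by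
  intro p hpr h5 A B C hA m r hm hr
  haveI : Fact p.Prime := ⟨hpr⟩
  rw [mul_comm m (p ^ r), mul_comm m (p ^ (r - 1))]
  exact ossS_prime_pow_modEq (p := p) h5 hA B C hr hm

end Assembly

end Literature.Combinatorics.Enumerative.SporadicSupercongruenceProofs
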